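import Summits.Ventures.Crystal3D.Theorems.StickyWulffConstantGenericWallFloorChamber
import HarnessLib

/-!
# A generic direction near `e₃`: no slot is level, no two slots tie, the steepest slot is unique
# (crux `GenericWallFloor`, line `WallLedgerG`; the «perturbation n′ of ν» of the chain ledger §81(3))

HONEST FRAMING. Part of the venture `Summits/Ventures/Crystal3D` (cell `crystal3d-full`), helper
`--supports` the crux `GenericWallFloor` (stmt-Ventures-19480), registered line `WallLedgerG`, open stub
`stub_twoSlabAdhesion`.  cf-p1 ROUTE §81(3): «Fix ν = e₃ and a perturbation n′ of ν inside an O_h-chamber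
of Λ₁'s frame (generic: the 12 values ⟪A₁w, n′⟫ distinct and ≠ 0); U6 := the six slots with ⟪A₁w,n′⟫ > 0,
δ₀ := the steepest.»  The chamber facts (`…Chamber`) take a STRICT maximiser `δ₀`; this file supplies it:

* `exists_generic_direction` — for a finite set of non-zero vectors and `ε > 0` there is `n` with
  `‖n − e₃‖ < ε` off all their orthogonal hyperplanes (`n = e₃ + t e₀ + t² e₁`, `t` below the threshold at
  which the lowest non-zero coefficient of `v₂ + t v₀ + t² v₁` dominates — no root counting);
* **`exists_generic_slot_direction`** — for every frame `A` and `ε > 0`: `n` within `ε` of `e₃` with no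
  level slot, no tie between slots, and a strict steepest slot `δ₀ ∈ fccSlots`.

WHAT THIS IS NOT: the choice of `ε` that makes `U6(n) ⊇ {w : ⟪A w, e₃⟫ > 0}` (take `ε` below the least
non-zero `|⟪A w, e₃⟫|`) is left to the ledger file; rung F-C1 not moved.
-/

noncomputable section

namespace Summit.Ventures.Crystal3D.Theorems

open Finset
open scoped InnerProductSpace

/-- **Avoiding finitely many hyperplanes near `e₃`.**  For a finite set `V` of non-zero vectors and
`ε > 0` there is `n` with `‖n − e₃‖ < ε` and `⟪v, n⟫ ≠ 0` for all `v ∈ V`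
(take `n = e₃ + t e₀ + t² e₁` with `t > 0` small: `⟪v, n⟫ = v₂ + t v₀ + t² v₁` is a non-zero polynomial
whose lowest non-zero coefficient dominates for small `t`). -/
theorem exists_generic_direction (V : Finset (EuclideanSpace ℝ (Fin 3))) (hV : ∀ v ∈ V, v ≠ 0)
    {ε : ℝ} (hε : 0 < ε) :
    ∃ n : EuclideanSpace ℝ (Fin 3), ‖n - EuclideanSpace.single (2 : Fin 3) (1 : ℝ)‖ < ε ∧
      ∀ v ∈ V, ⟪v, n⟫_ℝ ≠ 0 := by
  classical
  -- threshold per vector: below it the lowest non-zero coefficient dominates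
  let θ : EuclideanSpace ℝ (Fin 3) → ℝ := fun v =>
    if v 2 ≠ 0 then |v 2| / (|v 0| + |v 1| + 1) else if v 0 ≠ 0 then |v 0| / (|v 1| + 1) else 1
  have hθpos : ∀ v, 0 < θ v := by
    intro v
    simp only [θ]
    split_ifs with h2 h0
    · exact div_pos (abs_pos.2 h2) (by positivity)
    · exact div_pos (abs_pos.2 h0) (by positivity)
    · exact one_pos
  -- a common small positive `t`
  obtain ⟨t, ht0, htε, htθ⟩ : ∃ t : ℝ, 0 < t ∧ t < min ε 1 / 2 ∧ ∀ v ∈ V, t < θ v := by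
    by_cases hne : V.Nonempty
    · set m := V.inf' hne θ with hm
      have hmpos : 0 < m := by
        rw [hm, Finset.lt_inf'_iff]; intro v _; exact hθpos v
      refine ⟨min (min ε 1 / 2) m / 2, by positivity, ?_, fun v hv => ?_⟩
      · have : min (min ε 1 / 2) m ≤ min ε 1 / 2 := min_le_left _ _
        have h2 : 0 < min ε 1 / 2 := by positivity
        linarith
      · have h1 : min (min ε 1 / 2) m ≤ m := min_le_right _ _
        have h2 : m ≤ θ v := Finset.inf'_le _ hv
        have h3 : 0 < θ v := hθpos v
        linarith
    · refine ⟨min ε 1 / 4, by positivity, ?_, fun v hv => (hne ⟨v, hv⟩).elim⟩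
      have : 0 < min ε 1 := by positivity
      linarith
  have ht1 : t < 1 := by
    have : min ε 1 / 2 ≤ 1 / 2 := by
      have := min_le_right ε 1; linarith
    linarith
  set e0 : EuclideanSpace ℝ (Fin 3) := EuclideanSpace.single (0 : Fin 3) (1 : ℝ)
  set e1 : EuclideanSpace ℝ (Fin 3) := EuclideanSpace.single (1 : Fin 3) (1 : ℝ)
  set e2 : EuclideanSpace ℝ (Fin 3) := EuclideanSpace.single (2 : Fin 3) (1 : ℝ)
  refine ⟨e2 + t • e0 + t ^ 2 • e1, ?_, ?_⟩
  · -- `‖t e₀ + t² e₁‖ ≤ t + t² < ε`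
    have hnorm : ‖e2 + t • e0 + t ^ 2 • e1 - e2‖ ≤ t + t ^ 2 := by
      rw [show e2 + t • e0 + t ^ 2 • e1 - e2 = t • e0 + t ^ 2 • e1 by abel]
      calc ‖t • e0 + t ^ 2 • e1‖ ≤ ‖t • e0‖ + ‖t ^ 2 • e1‖ := norm_add_le _ _
        _ = t + t ^ 2 := by
          rw [norm_smul, norm_smul, Real.norm_of_nonneg ht0.le, Real.norm_of_nonneg (by positivity)]
          simp [e0, e1]
    have : t + t ^ 2 < ε := by
      have hmin : min ε 1 / 2 ≤ ε / 2 := by have := min_le_left ε 1; linarith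
      nlinarith
    linarith
  · intro v hv h0
    have hin : ⟪v, e2 + t • e0 + t ^ 2 • e1⟫_ℝ = v 2 + t * v 0 + t ^ 2 * v 1 := by
      simp only [inner_add_right, real_inner_smul_right, e0, e1, e2, EuclideanSpace.inner_single_right]
      simp
    rw [hin] at h0
    have hθv := htθ v hv
    simp only [θ] at hθv
    by_cases h2 : v 2 ≠ 0
    · rw [if_pos h2] at hθv
      -- `|t v₀ + t² v₁| ≤ t (|v₀| + |v₁|) < |v₂|`
      have hden : 0 < |v 0| + |v 1| + 1 := by positivity
      have ht' : t * (|v 0| + |v 1| + 1) < |v 2| := (lt_div_iff₀ hden).1 hθv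
      have hb : |t * v 0 + t ^ 2 * v 1| ≤ t * (|v 0| + |v 1|) := by
        have e1 : |t * v 0| = t * |v 0| := by rw [abs_mul, abs_of_pos ht0]
        have e2 : |t ^ 2 * v 1| = t ^ 2 * |v 1| := by rw [abs_mul, abs_of_pos (pow_pos ht0 2)]
        have ht2 : t ^ 2 ≤ t := by nlinarith
        have h3 : t ^ 2 * |v 1| ≤ t * |v 1| := mul_le_mul_of_nonneg_right ht2 (abs_nonneg _)
        calc |t * v 0 + t ^ 2 * v 1| ≤ |t * v 0| + |t ^ 2 * v 1| := abs_add_le _ _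
          _ ≤ t * (|v 0| + |v 1|) := by rw [e1, e2]; linarith
      have : |v 2| ≤ |t * v 0 + t ^ 2 * v 1| := by
        have e : v 2 = -(t * v 0 + t ^ 2 * v 1) := by linarith
        rw [e, abs_neg]
      nlinarith [abs_nonneg (v 0), abs_nonneg (v 1)]
    · push Not at h2
      by_cases hv0 : v 0 ≠ 0
      · rw [if_neg (not_not.2 h2), if_pos hv0] at hθv
        have hden : 0 < |v 1| + 1 := by positivity
        have ht' : t * (|v 1| + 1) < |v 0| := (lt_div_iff₀ hden).1 hθv
        -- `v₀ + t v₁ = 0` impossible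
        have e : v 0 = -(t * v 1) := by
          have : t * (v 0 + t * v 1) = 0 := by rw [h2] at h0; nlinarith [h0]
          rcases mul_eq_zero.1 this with h | h
          · exact absurd h ht0.ne'
          · linarith
        have : |v 0| ≤ t * |v 1| := by rw [e, abs_neg, abs_mul, abs_of_pos ht0]
        nlinarith [abs_nonneg (v 1)]
      · push Not at hv0
        -- then `v₁ ≠ 0` and `t² v₁ ≠ 0`
        have hv1 : v 1 ≠ 0 := by
          intro hv1
          apply hV v hv
          ext i; fin_cases i
          · simpa using hv0
          · simpa using hv1
          · simpa using h2
        rw [h2, hv0] at h0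
        have : t ^ 2 * v 1 = 0 := by linarith
        rcases mul_eq_zero.1 this with h | h
        · exact absurd h (by positivity)
        · exact hv1 h

/-- **A generic direction for a grain frame.**  For every frame `A` and `ε > 0` there is `n` within `ε` of
`e₃` such that no slot is level (`⟪A w, n⟫ ≠ 0`), no two slots tie, and hence the steepest slot `δ₀` is a
STRICT maximiser — the hypotheses of the chamber facts (`pos_of_adj_argmax`, `top_owns_closedStar`, …). -/
theorem exists_generic_slot_direction (A : EuclideanSpace ℝ (Fin 3) ≃ₗᵢ[ℝ] EuclideanSpace ℝ (Fin 3))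
    {ε : ℝ} (hε : 0 < ε) :
    ∃ n : EuclideanSpace ℝ (Fin 3), ‖n - EuclideanSpace.single (2 : Fin 3) (1 : ℝ)‖ < ε ∧
      (∀ w ∈ fccSlots, ⟪A w, n⟫_ℝ ≠ 0) ∧
      (∀ w ∈ fccSlots, ∀ w' ∈ fccSlots, w ≠ w' → ⟪A w, n⟫_ℝ ≠ ⟪A w', n⟫_ℝ) ∧
      ∃ δ₀ ∈ fccSlots, ∀ w ∈ fccSlots, w ≠ δ₀ → ⟪A w, n⟫_ℝ < ⟪A δ₀, n⟫_ℝ := by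
  classical
  set V : Finset (EuclideanSpace ℝ (Fin 3)) :=
    fccSlots.image (fun w => A w) ∪ (fccSlots ×ˢ fccSlots).image (fun p => A p.1 - A p.2) \ {0} with hV
  have hV0 : ∀ v ∈ V, v ≠ 0 := by
    intro v hv
    rcases Finset.mem_union.1 hv with h | h
    · obtain ⟨w, hw, rfl⟩ := Finset.mem_image.1 h
      intro h0
      have := norm_eq_one_of_mem_fccSlots hw
      rw [← A.norm_map, h0, norm_zero] at this; exact one_ne_zero this.symm
    · exact (Finset.mem_sdiff.1 h).2 ∘ Finset.mem_singleton.2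
  obtain ⟨n, hn, hgen⟩ := exists_generic_direction V hV0 hε
  have hslot : ∀ w ∈ fccSlots, ⟪A w, n⟫_ℝ ≠ 0 := fun w hw =>
    hgen _ (Finset.mem_union_left _ (Finset.mem_image.2 ⟨w, hw, rfl⟩))
  have htie : ∀ w ∈ fccSlots, ∀ w' ∈ fccSlots, w ≠ w' → ⟪A w, n⟫_ℝ ≠ ⟪A w', n⟫_ℝ := by
    intro w hw w' hw' hne heq
    have hmem : A w - A w' ∈ V := by
      refine Finset.mem_union_right _ (Finset.mem_sdiff.2 ⟨Finset.mem_image.2 ⟨(w, w'),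
        Finset.mem_product.2 ⟨hw, hw'⟩, rfl⟩, ?_⟩)
      rw [Finset.mem_singleton, sub_eq_zero]
      exact fun h => hne (A.injective h)
    exact hgen _ hmem (by rw [inner_sub_left, heq, sub_self])
  refine ⟨n, hn, hslot, htie, ?_⟩
  have hne : fccSlots.Nonempty := by
    rw [← Finset.card_pos, card_fccSlots]; norm_num
  obtain ⟨δ₀, hδ₀, hmax⟩ := Finset.exists_max_image fccSlots (fun w => ⟪A w, n⟫_ℝ) hne
  exact ⟨δ₀, hδ₀, fun w hw hwne => lt_of_le_of_ne (hmax w hw) (htie w hw δ₀ hδ₀ hwne)⟩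

end Summit.Ventures.Crystal3D.Theorems

end
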